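import Summits.QuantumAdvantage.QuantumAdvantage.Theorems.CharDialCounterSubcube
import Summits.QuantumAdvantage.QuantumAdvantage.Theorems.CharDialJLinSlice
import HarnessLib

/-!
# Prefix counters with UNREAD positions lose — the READ-COVER DIAL at tree level (decomp-qadv lens-6 g13, tree part 23)

**`JLinPeel.prefixUnread_hard_unif`** (prime `p ≠ 3`): junta ⊕ linear-form data `D : JLinData p n` whose forms are PREFIX COUNTERS
(`D.a g = t_g·𝟙_{[0,g)}`: cut `g` reads an ARBITRARY junta `D.J g` — no size bound — and the running weight `W_{<g} mod p` through
an arbitrary table) win α's u-walk game on at most `θ·2ⁿ` inputs as soon as `≥ m₀(p)` input positions are read by NO junta — ONE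
`θ < 1`, ONE `m₀`, every `n`.  PROOF: freeze the read positions (`W`, `subcubeMerge`); on each subcube the tables are constants
(`D.hJ`) and the form is `t_g·W_{<g}` (`form_prefix`), so the strategy is counter-measurable ON THE SUBCUBE and part 22's R13 on
subcubes (`counterSubcubeHard_of_prime`) bounds the wins there; fibre counting (`sum_card_subcube`).  In the «SliceDial» node this
is `UnreadBitsHard p`, which makes the read-cover dial of the prefix face of CharDial's item unconditional
(`PrefixFormHard p ⟺ PrefixCoreHard p`, prime `p ≥ 5`): what remains open there is the time-dense ∧ read-covered core.
-/

namespace Summit.QuantumAdvantage.AdviceFreeQNC0.JLinPeel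

open Finset AffBells22

section PrefixUnread

variable {p : ℕ}

/-- the value of a PREFIX form: `⟨t·𝟙_{[0,g)}, u⟩ = t · W_{<g}(u)`. -/
theorem form_prefix {n : ℕ} (D : JLinData p n) {g : Fin (n + 1)} {t : ZMod p}
    (ha : D.a g = fun i => if i.val < g.val then t else 0) (u : Fin n → Bool) :
    D.form g u = t * (wtPrefix u g.val : ZMod p) := by
  classical
  unfold JLinData.form wtPrefix
  rw [ha]
  have e : ∀ i : Fin n, (if u i = true then (fun i : Fin n => if i.val < g.val then t else 0) i else 0) =
      if (i.val < g.val ∧ u i = true) then t else 0 := fun i => by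
    by_cases h1 : u i = true <;> by_cases h2 : i.val < g.val <;> simp [h1, h2]
  rw [sum_congr rfl fun i _ => e i, ← sum_filter, sum_const, nsmul_eq_mul, mul_comm]

variable [Fact p.Prime]

/-- **prefix counters ⊕ juntas with `≥ m₀` UNREAD positions lose** (prime `p ≠ 3`; juntas of any size; every `n`). -/
theorem prefixUnread_hard_unif (hp3 : p ≠ 3) :
    ∃ θ : ℝ, θ < 1 ∧ ∃ m₀ : ℕ, ∀ (n c : ℕ) (D : JLinData p n),
      (∀ g, ∃ t : ZMod p, D.a g = fun i => if i.val < g.val then t else 0) →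
      m₀ ≤ (univ.filter fun i : Fin n => ∀ g, i ∉ D.J g).card →
      (winCount c D.strat : ℝ) ≤ θ * (2 : ℝ) ^ n := by
  classical
  obtain ⟨θ, hθ, m₀, hsub⟩ := counterSubcubeHard_of_prime p hp3
  refine ⟨θ, hθ, m₀, fun n c D hpre hm => ?_⟩
  set U : Finset (Fin n) := univ.filter fun i : Fin n => ∀ g, i ∉ D.J g with hU
  set W : Finset (Fin n) := univ.filter fun i : Fin n => ¬ (∀ g, i ∉ D.J g) with hW
  have hUW : U.card + W.card = n := by
    have := Finset.card_filter_add_card_filter_not (s := (univ : Finset (Fin n))) (fun i : Fin n => ∀ g, i ∉ D.J g)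
    simpa [hU, hW] using this
  have hWn : m₀ + W.card ≤ n := by omega
  -- on every subcube over `W` the strategy is counter-measurable
  have hmeas : ∀ b : Fin n → Bool, ∀ g : Fin (n + 1), ∀ u v : Fin n → Bool,
      wtPrefix (subcubeMerge W b u) g.val % p = wtPrefix (subcubeMerge W b v) g.val % p →
      D.strat g (subcubeMerge W b u) = D.strat g (subcubeMerge W b v) := by
    intro b g u v huv
    obtain ⟨t, ht⟩ := hpre g
    have hJ : ∀ i ∈ D.J g, subcubeMerge W b u i = subcubeMerge W b v i := by
      intro i hi
      have hiW : i ∈ W := mem_filter.2 ⟨mem_univ _, fun hall => hall g hi⟩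
      simp [subcubeMerge, hiW]
    have hcast : ((wtPrefix (subcubeMerge W b u) g.val : ℕ) : ZMod p)
        = ((wtPrefix (subcubeMerge W b v) g.val : ℕ) : ZMod p) :=
      (ZMod.natCast_eq_natCast_iff' _ _ _).2 huv
    show D.h g (subcubeMerge W b u) (D.form g (subcubeMerge W b u))
      = D.h g (subcubeMerge W b v) (D.form g (subcubeMerge W b v))
    rw [form_prefix D ht, form_prefix D ht, hcast, D.hJ g _ _ hJ]
  have hb : ∀ b : Fin n → Bool,
      ((univ.filter fun u : Fin n → Bool => ringWinU c D.strat (subcubeMerge W b u) = true).card : ℝ) ≤ θ * (2 : ℝ) ^ n :=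
    fun b => hsub n c W b D.strat hWn (hmeas b)
  -- fibre counting
  have hsum := sum_card_subcube W (fun u : Fin n → Bool => ringWinU c D.strat u = true)
  have h2n : (0 : ℝ) < 2 ^ n := by positivity
  have hR : (2 : ℝ) ^ n * (winCount c D.strat : ℝ) ≤ (2 : ℝ) ^ n * (θ * 2 ^ n) := by
    have e1 : (2 : ℝ) ^ n * (winCount c D.strat : ℝ) =
        ∑ b : Fin n → Bool,
          ((univ.filter fun u : Fin n → Bool => ringWinU c D.strat (subcubeMerge W b u) = true).card : ℝ) := by
      unfold winCount; rw [← Nat.cast_sum, hsum]; push_cast; ring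
    rw [e1]
    calc _ ≤ ∑ b : Fin n → Bool, θ * (2 : ℝ) ^ n := sum_le_sum fun b _ => hb b
      _ = (2 : ℝ) ^ n * (θ * 2 ^ n) := by
          rw [sum_const, card_univ, Fintype.card_fun, Fintype.card_bool, Fintype.card_fin]; simp
  exact le_of_mul_le_mul_left hR h2n

end PrefixUnread

end Summit.QuantumAdvantage.AdviceFreeQNC0.JLinPeel
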